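import Summits.Schanuel.Schanuel.Theorems.RootDecomp1BStoreyOneAtlas01

/-!
# RootDecomp1BStoreyOneAtlas — lens 4, generation 28 «STOREY-ONE ATLAS» (StoreyOneAtlas.lean f91ffd05…, 655 l) — continuation (RootDecomp1BStoreyOneAtlas02): §3b storey-one cells off A ⊕ Aπ (hyper-Liouville classes incl. the flagship `kleinPolarCellOne_exp_pi_mul_lambdaH`, log·HL / arg·HL mod NW96), §4 certification `r ∉ A ⊕ Aπ` (`pi_mul_lambdaH_not_mem_spanOnePi`), §5 co-countable normal form (`countable_storeyOne_failures`), §6 reading against the live crux (`storeyOne_of_crux`)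

(lens-4 g28 `StoreyOneAtlas.lean`, sha256 f91ffd05…7d78, farm rc 0 · 0 warnings · 0 sorry · axioms standard; critic VERDICT STATUS L1569: ONE cell-decision credit on 1B to
lens-4 (X(1) at r = π·λ_H, hypothesis-free), EC-row 24622 rider, (iii) optional PORT GO LOW via the census lane; port by census-1 gen 14 in two parts
RootDecomp1BStoreyOneAtlas01/02 (cut at §3b; the `set_option linter.dupNamespace false` line dropped, `isAlgebraic_sqrt_three` / `schanuelRank_one'` made private);
statements and proofs verbatim; the two Nesterenko binders stay binders; `--supports stmt-Schanuel-24622` (X = KleinPolarSchanuel). Nothing here proves Schanuel; rung 0.)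
-/

noncomputable section

open Complex IntermediateField Polynomial

namespace Summit.Schanuel.Schanuel.Theorems.RootDecomp1BStoreyOneAtlas

open Summit.Schanuel.Schanuel.Theorems.RootDecomp1BTranscendencePackageFloor (A Qb mem_Qb_iff mem_A_iff_coe_mem_Qb)
open Summit.Schanuel.Schanuel.Theorems.RootDecomp1BFinitePinningFloor (KleinPolarCellOne spanOnePi
  kleinPolarCellOne_exp_of_kleinPolarSchanuel)
open Summit.Schanuel.Schanuel.Theorems.RootDecomp1BPeriodKernelFloor (algebraicIndependent_pi_expPi_complex)
open Summit.Schanuel.Schanuel.Theorems.RootDecomp1KHyper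
open Summit.Schanuel.Schanuel.Theorems.RootDecomp1KHyper.HyperCell
open Summit.Schanuel.Schanuel.Theorems.RootDecomp1KRadical (FiniteTranscendenceType)
open Summit.Schanuel.Schanuel.Theorems.RootDecomp1KKummerClosure (algebraicIndependent_logCell
  finiteTranscendenceType_log)
open Literature.NumberTheory.Transcendental

/-- `trdeg_ℚ` is monotone along inclusions of subfields. [folklore] -/
private theorem trdeg_mono {F E : Type*} [Field F] [Field E] [Algebra F E] {L L' : IntermediateField F E}
    (h : L ≤ L') : Algebra.trdeg F L ≤ Algebra.trdeg F L' :=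
  trdeg_le_of_injective (IntermediateField.inclusion h) (IntermediateField.inclusion_injective h)

/-- A field generated by a set `S` has transcendence degree `≤ #S`. [folklore] -/
private theorem trdeg_adjoin_le_mk {F E : Type*} [Field F] [Field E] [Algebra F E] (S : Set E) :
    Algebra.trdeg F ↥(adjoin F S) ≤ Cardinal.mk S := by
  haveI := Literature.NumberTheory.Transcendental.isAlgebraic_adjoin_over_algebraAdjoin (F := F) S
  exact (Algebra.IsAlgebraic.trdeg_le_cardinalMk F (((↑) : adjoin F S → E) ⁻¹' S)).trans
    (Cardinal.mk_preimage_of_injective _ _ Subtype.val_injective)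

set_option synthInstance.maxHeartbeats 400000 in

/-- Subadditivity `trdeg_K K(S ∪ T) ≤ trdeg_K K(S) + trdeg_K K(T)`. [folklore] -/
private theorem trdeg_adjoin_union_le {K E : Type*} [Field K] [Field E] [Algebra K E] (S T : Set E) :
    Algebra.trdeg K ↥(adjoin K (S ∪ T)) ≤
      Algebra.trdeg K ↥(adjoin K S) + Algebra.trdeg K ↥(adjoin K T) := by
  have htower := trdeg_add_eq K (adjoin K S) (A := adjoin (adjoin K S) T)
  have heq : Algebra.trdeg K (adjoin (adjoin K S) T) = Algebra.trdeg K (adjoin K (S ∪ T)) := by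
    rw [← (equivOfEq (adjoin_adjoin_left K S T)).trdeg_eq]
    rfl
  have hbc := Literature.NumberTheory.Transcendental.trdeg_adjoin_le_of_le (K := K) (E := E)
    (F₁ := adjoin K (∅ : Set E)) (F₂ := adjoin K S) (adjoin.mono K _ _ (Set.empty_subset S)) T
  have htower0 := trdeg_add_eq K (adjoin K (∅ : Set E)) (A := adjoin (adjoin K (∅ : Set E)) T)
  have heq0 : Algebra.trdeg K (adjoin (adjoin K (∅ : Set E)) T) = Algebra.trdeg K (adjoin K T) := by
    have h1 : Algebra.trdeg K ↥(adjoin K T) = Algebra.trdeg K ↥(adjoin K (∅ ∪ T)) := by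
      rw [Set.empty_union]
    rw [h1, ← (equivOfEq (adjoin_adjoin_left K ∅ T)).trdeg_eq]
    rfl
  have hzero : Algebra.trdeg K ↥(adjoin K (∅ : Set E)) = 0 :=
    nonpos_iff_eq_zero.mp ((trdeg_adjoin_le_mk (F := K) (∅ : Set E)).trans (by simp))
  rw [hzero, zero_add, heq0] at htower0
  rw [heq] at htower
  rw [← htower, ← htower0]
  gcongr

set_option synthInstance.maxHeartbeats 400000 in

/-- `k` algebraically independent numbers generate a field of transcendence degree `≥ k`. [folklore] -/
private theorem le_trdeg_adjoin_of_algebraicIndependent {ι : Type} [Fintype ι] {y : ι → ℂ}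
    (h : AlgebraicIndependent ℚ y) :
    (Fintype.card ι : Cardinal) ≤ Algebra.trdeg ℚ ↥(adjoin ℚ (Set.range y)) := by
  let f : ι → adjoin ℚ (Set.range y) := fun i => ⟨y i, subset_adjoin ℚ _ ⟨i, rfl⟩⟩
  have hf : AlgebraicIndependent ℚ f := AlgebraicIndependent.of_comp (adjoin ℚ (Set.range y)).val h
  simpa using hf.cardinalMk_le_trdeg

/-! ## §3b Decided storey-one cells OFF `A ⊕ Aπ` -/

/-- **Cell (HL)**: `X(1)(r)` for every hyper-Liouville real `r`, mod NW 1996 Thm 5(1)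
(lens 6: `sb_hyperLiouville_pair`, `explicitRatExpApprox_of_NW1996`).
[cite: NesterenkoWaldschmidt1996, Theorem 5 (1)] -/
theorem kleinPolarCellOne_exp_of_hyperLiouville (hNW : NesterenkoWaldschmidt1996_thm_5_1)
    {r : ℝ} (hr : HyperLiouville r) : KleinPolarCellOne cexp r :=
  (kleinPolarCellOne_exp_iff r).mpr
    (sb_hyperLiouville_pair (explicitRatExpApprox_of_NW1996 hNW) hr ((r : ℂ) * I)).1

/-- **Cell (πHL), HYPOTHESIS-FREE**: `X(1)(s·π·ρ)` for every hyper-Liouville `ρ` and `s ∈ ℚ^×` — from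
lens 6's torsion independence `(ρ', π, e^{2πiρ'})` at `ρ' = (s/2)ρ` and the generator drop with `c = π`:
`ℚ(r, ir, e^r, e^{ir}, i, π) ∋ ρ' = r/(2π), π, e^{2πiρ'} = e^{ir}`. [folklore] -/
theorem kleinPolarCellOne_exp_of_ratPi_mul_hyperLiouville {ρ : ℝ} (hρ : HyperLiouville ρ) {s : ℚ}
    (hs : s ≠ 0) : KleinPolarCellOne cexp ((s : ℝ) * Real.pi * ρ) := by
  have hs2 : s / 2 ≠ 0 := div_ne_zero hs two_ne_zero
  have hρ' : HyperLiouville (((s / 2 : ℚ) : ℝ) * ρ) := hρ.rat_mul hs2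
  have hai := algebraicIndependent_torsion hρ'
  have hπ0 : (Real.pi : ℂ) ≠ 0 := ofReal_ne_zero.mpr Real.pi_ne_zero
  set r : ℝ := (s : ℝ) * Real.pi * ρ with hr
  refine (kleinPolarCellOne_exp_iff r).mpr
    (sb_of_algebraicIndependent_adjoin_one hai (Real.pi : ℂ) (by simp) fun j => ?_)
  have h0 : (r : ℂ) ∈ adjoin ℚ (SFset (polarPair r) ∪ {I} ∪ {(Real.pi : ℂ)}) :=
    mem_F_coord (polarPair r) _ 0
  have h1 : cexp ((r : ℂ) * I) ∈ adjoin ℚ (SFset (polarPair r) ∪ {I} ∪ {(Real.pi : ℂ)}) :=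
    mem_F_exp (polarPair r) _ 1
  have hπ : (Real.pi : ℂ) ∈ adjoin ℚ (SFset (polarPair r) ∪ {I} ∪ {(Real.pi : ℂ)}) :=
    mem_F_aux (polarPair r) _
  fin_cases j
  · -- `ρ' = r / (2π)`
    have e : ((((s / 2 : ℚ) : ℝ) * ρ : ℝ) : ℂ) = (r : ℂ) / (2 * (Real.pi : ℂ)) := by
      rw [eq_div_iff (mul_ne_zero two_ne_zero hπ0), hr]; push_cast; ring
    show ((((s / 2 : ℚ) : ℝ) * ρ : ℝ) : ℂ) ∈ _
    rw [e]
    exact div_mem h0 (mul_mem (by exact_mod_cast (adjoin ℚ _).natCast_mem 2 : ((2 : ℕ) : ℂ) ∈ _) hπ)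
  · exact hπ
  · -- `e^{2πiρ'} = e^{ir}`
    have e : cexp (2 * (Real.pi : ℂ) * I * ((((s / 2 : ℚ) : ℝ) * ρ : ℝ) : ℂ)) = cexp ((r : ℂ) * I) := by
      congr 1; rw [hr]; push_cast; ring
    show cexp (2 * (Real.pi : ℂ) * I * ((((s / 2 : ℚ) : ℝ) * ρ : ℝ) : ℂ)) ∈ _
    rw [e]
    exact h1

/-- In particular at `s = 1`: `X(1)(π·ρ)` for every hyper-Liouville `ρ`, hypothesis-free. [folklore] -/
theorem kleinPolarCellOne_exp_of_pi_mul_hyperLiouville {ρ : ℝ} (hρ : HyperLiouville ρ) :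
    KleinPolarCellOne cexp (Real.pi * ρ) := by
  simpa using kleinPolarCellOne_exp_of_ratPi_mul_hyperLiouville hρ one_ne_zero

/-- **The EXPLICIT cell**: `X(1)` holds at `r = π·λ_H`, `λ_H = Σ_k 2^{-a_k}` (`a₀ = 1`, `a_{k+1} = 2^{(k+1)a_k}`)
lens 6's certified hyper-Liouville constant — `trdeg ℚ(πλ_H, e^{πλ_H}, e^{iπλ_H}) ≥ 2`, HYPOTHESIS-FREE. [folklore] -/
theorem kleinPolarCellOne_exp_pi_mul_lambdaH : KleinPolarCellOne cexp (Real.pi * lambdaH) :=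
  kleinPolarCellOne_exp_of_pi_mul_hyperLiouville hyperLiouville_lambdaH

/-- The signed log-cell engine behind (logHL)/(argHL): for `e^λ ∈ ℚ̄ ∖ μ_∞` (finite transcendence type of
`λ` from NW 1996 Thm 1) and a hyper-Liouville `ρ` of EITHER sign, `SB 2 z` as soon as `ℚ(z, e^z, i, c)`
contains `ρ, λ, e^{λρ}` (lens 6's `algebraicIndependent_logCell` at `(|ρ|, ±λ)` + the generator drop).
[cite: NesterenkoWaldschmidt1996, Theorem 1] -/
theorem sb_two_of_logCell_mem (hNW : NesterenkoWaldschmidt1996_thm_1) {lam : ℂ}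
    (hαalg : IsAlgebraic ℚ (cexp lam)) (htor : ∀ n : ℕ, 0 < n → cexp lam ^ n ≠ 1)
    {ρ : ℝ} (hρ : HyperLiouville ρ) {z : Fin 2 → ℂ} (c : ℂ)
    (h0 : (ρ : ℂ) ∈ adjoin ℚ (SFset z ∪ {I} ∪ {c})) (h1 : lam ∈ adjoin ℚ (SFset z ∪ {I} ∪ {c}))
    (h2 : cexp (lam * ρ) ∈ adjoin ℚ (SFset z ∪ {I} ∪ {c})) : SB 2 z := by
  have hl0 : lam ≠ 0 := by
    rintro rfl; exact htor 1 one_pos (by rw [Complex.exp_zero, one_pow])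
  rcases lt_or_gt_of_ne hρ.ne_zero with hneg | hpos
  · -- `ρ < 0`: run the engine at `(-ρ, -λ)`
    have hρ' : HyperLiouville (((-1 : ℚ) : ℝ) * ρ) := hρ.rat_mul (by norm_num)
    have hρ'' : HyperLiouville (-ρ) := by simpa using hρ'
    have hpos' : 0 < -ρ := by linarith
    have hαalg' : IsAlgebraic ℚ (cexp (-lam)) := by
      rw [Complex.exp_neg]; exact IsAlgebraic.inv_iff.mpr hαalg
    have htor' : ∀ n : ℕ, 0 < n → cexp (-lam) ^ n ≠ 1 := by
      intro n hn h
      apply htor n hn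
      rwa [Complex.exp_neg, inv_pow, inv_eq_one] at h
    have hft : FiniteTranscendenceType (-lam) :=
      finiteTranscendenceType_log hNW (neg_ne_zero.mpr hl0) hαalg'
    have hai := algebraicIndependent_logCell rfl hft hαalg' htor' hρ'' hpos'
    refine sb_of_algebraicIndependent_adjoin_one hai c (by simp) fun j => ?_
    fin_cases j
    · show (((-ρ : ℝ)) : ℂ) ∈ _
      rw [Complex.ofReal_neg]
      exact neg_mem h0
    · exact neg_mem h1
    · show cexp (-lam * (((-ρ : ℝ)) : ℂ)) ∈ _
      rw [Complex.ofReal_neg, neg_mul_neg]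
      exact h2
  · have hft : FiniteTranscendenceType lam := finiteTranscendenceType_log hNW hl0 hαalg
    have hai := algebraicIndependent_logCell rfl hft hαalg htor hρ hpos
    refine sb_of_algebraicIndependent_adjoin_one hai c (by simp) fun j => ?_
    fin_cases j
    · exact h0
    · exact h1
    · exact h2

/-- **Cell (logHL)**: `X(1)(ρ · log a)` for `a > 0` real algebraic, `a ≠ 1`, `ρ` hyper-Liouville, mod NW 1996
Thm 1 — generator drop with `c = log a`: `ℚ(r, ir, e^r, e^{ir}, i, log a) ∋ ρ = r / log a, log a, a^ρ = e^r`.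
[cite: NesterenkoWaldschmidt1996, Theorem 1] -/
theorem kleinPolarCellOne_exp_of_hyperLiouville_mul_log (hNW : NesterenkoWaldschmidt1996_thm_1)
    {a : ℝ} (ha : IsAlgebraic ℚ (a : ℂ)) (ha0 : 0 < a) (ha1 : a ≠ 1) {ρ : ℝ} (hρ : HyperLiouville ρ) :
    KleinPolarCellOne cexp (ρ * Real.log a) := by
  set r : ℝ := ρ * Real.log a with hr
  have hlam : cexp ((Real.log a : ℝ) : ℂ) = (a : ℂ) := by
    rw [← Complex.ofReal_exp, Real.exp_log ha0]
  have hαalg : IsAlgebraic ℚ (cexp ((Real.log a : ℝ) : ℂ)) := by rw [hlam]; exact ha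
  have htor : ∀ n : ℕ, 0 < n → cexp ((Real.log a : ℝ) : ℂ) ^ n ≠ 1 := by
    intro n hn h
    rw [hlam, ← Complex.ofReal_pow, Complex.ofReal_eq_one] at h
    exact ha1 ((pow_eq_one_iff_of_nonneg ha0.le hn.ne').mp h)
  have hl0 : Real.log a ≠ 0 := Real.log_ne_zero_of_pos_of_ne_one ha0 ha1
  refine (kleinPolarCellOne_exp_iff r).mpr
    (sb_two_of_logCell_mem hNW hαalg htor hρ ((Real.log a : ℝ) : ℂ) ?_ (mem_F_aux _ _) ?_)
  · have hl0C : ((Real.log a : ℝ) : ℂ) ≠ 0 := by exact_mod_cast hl0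
    have e : (ρ : ℂ) = (r : ℂ) / ((Real.log a : ℝ) : ℂ) := by
      rw [eq_div_iff hl0C, hr]; push_cast; ring
    rw [e]
    exact div_mem (mem_F_coord (polarPair r) _ 0) (mem_F_aux _ _)
  · have e : cexp (((Real.log a : ℝ) : ℂ) * (ρ : ℂ)) = cexp (r : ℂ) := by
      congr 1; rw [hr]; push_cast; ring
    rw [e]
    exact mem_F_exp (polarPair r) _ 0

/-- **Cell (argHL)**: `X(1)(ρ · θ)` for `θ` an argument of a NON-TORSION algebraic point of the unit circle
(`e^{iθ} ∈ ℚ̄ ∖ μ_∞`) and `ρ` hyper-Liouville, mod NW 1996 Thm 1 — generator drop with `c = θ`: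
`ℚ(r, ir, e^r, e^{ir}, i, θ) ∋ ρ = r/θ, iθ, e^{iθρ} = e^{ir}`. [cite: NesterenkoWaldschmidt1996, Theorem 1] -/
theorem kleinPolarCellOne_exp_of_hyperLiouville_mul_arg (hNW : NesterenkoWaldschmidt1996_thm_1)
    {θ : ℝ} (hβ : IsAlgebraic ℚ (cexp ((θ : ℂ) * I))) (htor : ∀ n : ℕ, 0 < n → cexp ((θ : ℂ) * I) ^ n ≠ 1)
    {ρ : ℝ} (hρ : HyperLiouville ρ) : KleinPolarCellOne cexp (ρ * θ) := by
  set r : ℝ := ρ * θ with hr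
  have hθ0 : θ ≠ 0 := by
    rintro rfl
    exact htor 1 one_pos (by simp)
  refine (kleinPolarCellOne_exp_iff r).mpr
    (sb_two_of_logCell_mem hNW hβ htor hρ (θ : ℂ) ?_ ?_ ?_)
  · have hθC : (θ : ℂ) ≠ 0 := by exact_mod_cast hθ0
    have e : (ρ : ℂ) = (r : ℂ) / (θ : ℂ) := by
      rw [eq_div_iff hθC, hr]; push_cast; ring
    rw [e]
    exact div_mem (mem_F_coord (polarPair r) _ 0) (mem_F_aux _ _)
  · exact mul_mem (mem_F_aux _ _) (mem_F_I _ _)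
  · have e : cexp ((θ : ℂ) * I * (ρ : ℂ)) = cexp ((r : ℂ) * I) := by
      congr 1; rw [hr]; push_cast; ring
    rw [e]
    exact mem_F_exp (polarPair r) _ 1

/-! ## §4 Certification `r ∉ A ⊕ Aπ` -/

/-- `r ∉ A ⊕ Aπ` as soon as `ℚ(r, π)` contains two algebraically independent numbers
(`r = a + bπ` would put `ℚ(r, π)` inside `ℚ(π, a, b)`, of transcendence degree `≤ 1`). [folklore] -/
theorem not_mem_spanOnePi_of_algebraicIndependent {ι : Type} [Fintype ι] {u : ι → ℂ}
    (hai : AlgebraicIndependent ℚ u) (h2 : 2 ≤ Fintype.card ι) {r : ℝ}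
    (hu : ∀ i, u i ∈ adjoin ℚ ({(r : ℂ)} ∪ {(Real.pi : ℂ)} : Set ℂ)) : r ∉ spanOnePi := by
  intro hmem
  rw [spanOnePi, Submodule.mem_span_range_iff_exists_fun] at hmem
  obtain ⟨c, hc⟩ := hmem
  rw [Fin.sum_univ_two] at hc
  simp only [Matrix.cons_val_zero, Matrix.cons_val_one] at hc
  have hc' : ((c 0 : ℝ) : ℂ) + ((c 1 : ℝ) : ℂ) * (Real.pi : ℂ) = (r : ℂ) := by
    have h1 : (c 0 : ℝ) + (c 1 : ℝ) * Real.pi = r := by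
      have h2 := hc
      simp only [Algebra.smul_def, mul_one] at h2
      exact h2
    exact_mod_cast congrArg ((↑) : ℝ → ℂ) h1
  have ha : IsAlgebraic ℚ ((c 0 : ℝ) : ℂ) := mem_Qb_iff.mp (mem_A_iff_coe_mem_Qb.mp (c 0).2)
  have hb : IsAlgebraic ℚ ((c 1 : ℝ) : ℂ) := mem_Qb_iff.mp (mem_A_iff_coe_mem_Qb.mp (c 1).2)
  -- `ℚ(r, π) ≤ ℚ(π, a, b)`
  set G : IntermediateField ℚ ℂ :=
    adjoin ℚ ({(Real.pi : ℂ)} ∪ ({((c 0 : ℝ) : ℂ)} ∪ {((c 1 : ℝ) : ℂ)}) : Set ℂ) with hG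
  have hπG : (Real.pi : ℂ) ∈ G := subset_adjoin ℚ _ (Or.inl (Set.mem_singleton _))
  have haG : ((c 0 : ℝ) : ℂ) ∈ G := subset_adjoin ℚ _ (Or.inr (Or.inl (Set.mem_singleton _)))
  have hbG : ((c 1 : ℝ) : ℂ) ∈ G := subset_adjoin ℚ _ (Or.inr (Or.inr (Set.mem_singleton _)))
  have hrG : (r : ℂ) ∈ G := by rw [← hc']; exact add_mem haG (mul_mem hbG hπG)
  have hle : adjoin ℚ ({(r : ℂ)} ∪ {(Real.pi : ℂ)} : Set ℂ) ≤ G := by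
    rw [adjoin_le_iff]
    rintro x (hx | hx)
    · rw [Set.mem_singleton_iff.mp hx]; exact hrG
    · rw [Set.mem_singleton_iff.mp hx]; exact hπG
  have hsub : Set.range u ⊆ (adjoin ℚ ({(r : ℂ)} ∪ {(Real.pi : ℂ)} : Set ℂ) : Set ℂ) := by
    rintro x ⟨i, rfl⟩; exact hu i
  have hle' : adjoin ℚ (Set.range u) ≤ G := (adjoin_le_iff.mpr hsub).trans hle
  -- transcendence degrees
  have hlow := (le_trdeg_adjoin_of_algebraicIndependent hai).trans (trdeg_mono hle')
  have hup : Algebra.trdeg ℚ G ≤ 1 := by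
    have h1 := trdeg_adjoin_union_le (K := ℚ) ({(Real.pi : ℂ)} : Set ℂ)
      (({((c 0 : ℝ) : ℂ)} ∪ {((c 1 : ℝ) : ℂ)}) : Set ℂ)
    have h2 := trdeg_adjoin_union_le (K := ℚ) ({((c 0 : ℝ) : ℂ)} : Set ℂ) ({((c 1 : ℝ) : ℂ)} : Set ℂ)
    rw [trdeg_adjoin_singleton_eq_zero ha.isIntegral, trdeg_adjoin_singleton_eq_zero hb.isIntegral,
      add_zero] at h2
    have h3 : Algebra.trdeg ℚ ↥(adjoin ℚ ({(Real.pi : ℂ)} : Set ℂ)) ≤ 1 :=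
      (trdeg_adjoin_le_mk (F := ℚ) ({(Real.pi : ℂ)} : Set ℂ)).trans (by simp)
    exact h1.trans ((add_le_add h3 h2).trans (by simp))
  have h : ((2 : ℕ) : Cardinal) ≤ 1 := le_trans (by exact_mod_cast h2) (hlow.trans hup)
  have h' : (2 : ℕ) ≤ 1 := by exact_mod_cast h
  omega

/-- **(HL) is certified**: a hyper-Liouville real is off `A ⊕ Aπ` — HYPOTHESIS-FREE, from lens 6's torsion
independence `(ρ, π, e^{2πiρ})`. [folklore] -/
theorem not_mem_spanOnePi_of_hyperLiouville {ρ : ℝ} (hρ : HyperLiouville ρ) : ρ ∉ spanOnePi := by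
  have hai := (algebraicIndependent_torsion hρ).comp (Fin.castLE (show 2 ≤ 3 by omega))
    (Fin.castLE_injective _)
  refine not_mem_spanOnePi_of_algebraicIndependent hai (by simp) fun j => ?_
  fin_cases j
  · exact subset_adjoin ℚ _ (Or.inl (Set.mem_singleton _))
  · exact subset_adjoin ℚ _ (Or.inr (Set.mem_singleton _))

/-- **(πHL) is certified**: `s·π·ρ ∉ A ⊕ Aπ` for `ρ` hyper-Liouville, `s ∈ ℚ^×` — HYPOTHESIS-FREE
(`ℚ(sπρ, π) ∋ ρ, π`). [folklore] -/
theorem not_mem_spanOnePi_ratPi_mul_hyperLiouville {ρ : ℝ} (hρ : HyperLiouville ρ) {s : ℚ}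
    (hs : s ≠ 0) : (s : ℝ) * Real.pi * ρ ∉ spanOnePi := by
  have hai := (algebraicIndependent_torsion hρ).comp (Fin.castLE (show 2 ≤ 3 by omega))
    (Fin.castLE_injective _)
  have hπ0 : (Real.pi : ℂ) ≠ 0 := ofReal_ne_zero.mpr Real.pi_ne_zero
  have hsC : (s : ℂ) ≠ 0 := by exact_mod_cast hs
  set r : ℝ := (s : ℝ) * Real.pi * ρ with hr
  have hrF : (r : ℂ) ∈ adjoin ℚ ({(r : ℂ)} ∪ {(Real.pi : ℂ)} : Set ℂ) :=
    subset_adjoin ℚ _ (Or.inl (Set.mem_singleton _))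
  have hπF : (Real.pi : ℂ) ∈ adjoin ℚ ({(r : ℂ)} ∪ {(Real.pi : ℂ)} : Set ℂ) :=
    subset_adjoin ℚ _ (Or.inr (Set.mem_singleton _))
  refine not_mem_spanOnePi_of_algebraicIndependent hai (by simp) fun j => ?_
  fin_cases j
  · have e : (ρ : ℂ) = (r : ℂ) / ((s : ℂ) * (Real.pi : ℂ)) := by
      rw [eq_div_iff (mul_ne_zero hsC hπ0), hr]; push_cast; ring
    show (ρ : ℂ) ∈ _
    rw [e]
    exact div_mem hrF (mul_mem (SubfieldClass.ratCast_mem _ s) hπF)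
  · exact hπF

/-- The explicit cell is certified: `π·λ_H ∉ A ⊕ Aπ`, hypothesis-free. [folklore] -/
theorem pi_mul_lambdaH_not_mem_spanOnePi : Real.pi * lambdaH ∉ spanOnePi := by
  simpa using not_mem_spanOnePi_ratPi_mul_hyperLiouville hyperLiouville_lambdaH one_ne_zero

/-! ## §5 The co-countable normal form (Kirby, proved in the tree) -/

/-- Schanuel in rank one (Hermite–Lindemann, proved in the tree). [cite: Roy2001, Conjecture 1] -/
private theorem schanuelRank_one' : SchanuelRank 1 :=
  Literature.Transcend.schanuelRank_one_of_transcendental_exp transcendental_exp_holds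

/-- **KIRBY CELL**: `X(1)(r)` for every non-zero real `r ∉ ecl ∅` — a storey-one failure is a SPAN-MINIMAL
counterexample of length two (rank one is Hermite–Lindemann), hence exponentially algebraic by piece K of route
RootDecomp1 (`essentialCounterexamplesInEcl_core`, from Kirby 2010 Thm 1.2, PROVED). [cite: Kirby2010, Prop. 7.2 and Thm. 1.2] -/
theorem kleinPolarCellOne_exp_of_not_mem_ecl {r : ℝ} (hr : r ≠ 0) (hE : (r : ℂ) ∉ ecl (∅ : Set ℂ)) :
    KleinPolarCellOne cexp r := by
  rw [kleinPolarCellOne_exp_iff]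
  by_contra hlt
  simp only [SB, not_le] at hlt
  refine hE (Summit.Schanuel.Schanuel.Theorems.RootDecomp1EssentialInEclCore.essentialCounterexamplesInEcl_core
    2 (polarPair r) (linearIndependent_polarPair hr) ?_ hlt 0)
  intro m hm w hw _
  interval_cases m
  · simp
  · exact schanuelRank_one' w hw

/-- **STOREY ONE FAILS AT MOST COUNTABLY OFTEN**: `{r ≠ 0 | ¬ X(1)(r)} ⊆ ecl ∅ ∩ ℝ` is countable
(countable closure property of `ℂ_exp`, PROVED in the tree). [cite: Kirby2010EAEF, §3 Remark 3.4] -/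
theorem countable_storeyOne_failures : {r : ℝ | r ≠ 0 ∧ ¬ KleinPolarCellOne cexp r}.Countable := by
  have hE : (ecl (∅ : Set ℂ)).Countable := hasCountableClosureProperty_complex_holds ∅ Set.countable_empty
  refine (hE.preimage Complex.ofReal_injective).mono ?_
  rintro r ⟨hr, hX⟩
  by_contra h
  exact hX (kleinPolarCellOne_exp_of_not_mem_ecl hr h)

/-! ## §6 Reading against the LIVE crux (sanity links, no new content) -/

/-- The live crux gives every storey-one cell (tree dictionary, restated for the record). [folklore] -/
theorem storeyOne_of_crux (hX : Summit.Schanuel.Schanuel.Theses.RootDecomp1B.KleinPolarSchanuel) {r : ℝ}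
    (hr : r ≠ 0) : KleinPolarCellOne cexp r :=
  kleinPolarCellOne_exp_of_kleinPolarSchanuel hX hr

end Summit.Schanuel.Schanuel.Theorems.RootDecomp1BStoreyOneAtlas
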